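import Summits.NavierStokesRegularity.NavierStokesRegularity.Theorems.TypeILiouvilleTypeIliouvilleNoTypeIIEternalEnergyLiouvilleSupAttained
import Literature.Analysis.FluidPDE.AncientL3BackwardLiouvilleHolds
import HarnessLib

/-!
# EEL′ on the `L³`-recurrent stratum, unconditionally: profiles with `L³`-bounded slices along a
# sequence of times `→ -∞` vanish (crux `TypeIliouvilleNoTypeII`, stmt-NavierStokesRegularity-0056;
# rigidity residual EEL′ of the pressure-free eternal split)

Helper file (theorems only).  The backward `L³` Liouville theorem of Albritton–Barker (Thm 1.2: a
bounded ancient Oseen-mild solution with `‖v(τ_k)‖_{L³} ≤ M` along `τ_k → -∞` vanishes) is a THEOREM of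
the tree (`AlbrittonBarker2019_liouville_L3_backward_holds`, run over the tree's Kato / local-energy
machinery).  Consequence for the EEL′ class (bounded eternal Oseen-mild smooth divergence-free
fields), with NO use of the energy bounds:

* `eq_zero_of_L3_slices_atBot` — a member with `‖v(τ_k)‖₃ ≤ M < ∞` along some `τ_k → -∞` is
  identically zero (time translates `v(· + T)` satisfy the Albritton–Barker hypotheses, `mild_translate`;
  the sequence is shifted and truncated to negative times);
* `eternalLiouvillePressureFree_L3_slices` — EEL′ in the exact `hEEL` shape on this stratum; in
  particular every member with `v ∈ L^∞_t L³_x` near `t = -∞` vanishes.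

So the open core of EEL′ is `L³`-DIVERGENT at `-∞`: `‖v(τ)‖_{L³(ℝ³)} → ∞` as `τ → -∞` (indeed
`= ∞` for all early times, or unbounded along every sequence).  WHAT THIS IS NOT: not NS; EEL′ stays
OPEN. [folklore]
-/

noncomputable section

-- the summit and its single problem share the name `NavierStokesRegularity` (D-0017 nested layout)
set_option linter.dupNamespace false

open Set Function Filter Topology MeasureTheory Metric
open scoped NNReal ENNReal

namespace Summit.NavierStokesRegularity.NavierStokesRegularity.Theorems.TypeIliouvilleNoTypeII.TypeIIZoom

open Literature.Analysis Literature.Analysis.FluidPDE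

variable {v : ℝ → EuclideanSpace ℝ (Fin 3) → EuclideanSpace ℝ (Fin 3)}

/-- **Albritton–Barker's backward `L³` Liouville theorem on the eternal profile.**  A bounded eternal
Oseen-mild smooth divergence-free field with `‖v(τ_k)‖_{L³} ≤ M < ∞` along a sequence `τ_k → -∞` is
identically zero. [cite: AlbrittonBarker2019, Thm. 1.2 (arXiv:1811.00502 p. 4)] -/
theorem eq_zero_of_L3_slices_atBot (hv : ContDiff ℝ (⊤ : ℕ∞) (uncurry v))
    (hdiv : ∀ t, VectorCalculus.IsDivFree (v t))
    (hmild : ∀ s t : ℝ, s < t → ∀ x, v t x = heatFlow (v s) (t - s) x - oseenDuhamel 1 s v v t x)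
    (hbdd : ∃ C : ℝ, ∀ t x, ‖v t x‖ ≤ C)
    (hL3 : ∃ (τ : ℕ → ℝ) (M : ℝ≥0∞), M < ⊤ ∧ Tendsto τ atTop atBot ∧
      ∀ k, eLpNorm (v (τ k)) 3 volume ≤ M)
    (t : ℝ) (x : EuclideanSpace ℝ (Fin 3)) : v t x = 0 := by
  obtain ⟨τ, M, hM, hτ, hτM⟩ := hL3
  obtain ⟨C, hC⟩ := hbdd
  have hslice : ∀ s, ContDiff ℝ (⊤ : ℕ∞) (v s) := fun s => hv.comp (contDiff_prodMk_right s)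
  -- the translate `w(s) = v(s + T)`, `T = t + 1`
  set T : ℝ := t + 1 with hT
  set w : ℝ → EuclideanSpace ℝ (Fin 3) → EuclideanSpace ℝ (Fin 3) := fun s y => v (s + T) (y + 0)
    with hw
  have hwv : ∀ s y, w s y = v (s + T) y := fun s y => by simp [hw]
  have hwcont : ContinuousOn (uncurry w) (Iio 0 ×ˢ univ) := by
    have e : uncurry w = uncurry v ∘ fun p : ℝ × EuclideanSpace ℝ (Fin 3) => (p.1 + T, p.2 + 0) := rfl
    rw [e]
    exact (hv.continuous.comp (by fun_prop)).continuousOn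
  have hwK : ∃ K : ℝ, ∀ s < 0, ∀ y, ‖w s y‖ ≤ K := ⟨C, fun s _ y => by rw [hwv]; exact hC _ _⟩
  have hwdiv : ∀ s < 0, IsWeaklyDivFree (w s) := fun s _ => by
    have e : w s = v (s + T) := funext fun y => hwv s y
    rw [e]
    exact VectorCalculus.IsDivFree.isWeaklyDivFree_holds (hdiv (s + T))
      ((hslice (s + T)).of_le (by exact_mod_cast le_top))
  have hwmild : ∀ s r : ℝ, s < r → r < 0 → ∀ y,
      w r y = UnboundedOperators.heatExtension (w s) (r - s) y - oseenDuhamel 1 s w w r y := by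
    intro s r hsr _ y
    have h := mild_translate hmild T 0 s r hsr y
    rw [heatFlow_of_pos _ (sub_pos.2 hsr)] at h
    exact h
  -- the shifted sequence, truncated to negative times
  have hτ' : Tendsto (fun k => τ k - T) atTop atBot := tendsto_atBot_add_const_right _ (-T) hτ
  obtain ⟨k₀, hk₀⟩ := (hτ'.eventually_lt_atBot 0).exists_forall_of_atTop
  have hseq : ∃ (σ : ℕ → ℝ) (M' : ℝ≥0∞), M' < ⊤ ∧ Tendsto σ atTop atBot ∧ (∀ k, σ k < 0) ∧
      ∀ k, eLpNorm (w (σ k)) 3 volume ≤ M' := by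
    refine ⟨fun k => τ (k + k₀) - T, M, hM, ?_, fun k => hk₀ (k + k₀) (Nat.le_add_left _ _), fun k => ?_⟩
    · exact hτ'.comp (tendsto_add_atTop_nat k₀)
    · have e : w (τ (k + k₀) - T) = v (τ (k + k₀)) := by
        funext y; rw [hwv, sub_add_cancel]
      rw [e]
      exact hτM _
  have hzero := AlbrittonBarker2019_liouville_L3_backward_holds hwcont hwK hwdiv hwmild hseq
    (-1) (by norm_num) x
  rw [hwv] at hzero
  have e : (-1 : ℝ) + T = t := by rw [hT]; ring
  rwa [e] at hzero

variable (v) in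
/-- **EEL′ holds on the `L³`-recurrent stratum** — in the exact hypothesis shape of
`EternalSplit.typeIliouvilleNoTypeII_of_pressureFreeSlab_of_eternalLiouville` (`hEEL`), restricted to
profiles with `‖v(τ_k)‖_{L³(ℝ³)} ≤ M < ∞` along some sequence `τ_k → -∞`.  Unconditional
(Albritton–Barker Thm 1.2 is a tree theorem); the energy clauses are not used. [cite: AlbrittonBarker2019, Thm. 1.2 (arXiv:1811.00502 p. 4)] -/
theorem eternalLiouvillePressureFree_L3_slices
    (hv : ContDiff ℝ (⊤ : ℕ∞) (uncurry v)) (hdiv : ∀ t, VectorCalculus.IsDivFree (v t))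
    (hmild : ∀ s t : ℝ, s < t → ∀ x, v t x = heatFlow (v s) (t - s) x - oseenDuhamel 1 s v v t x)
    (hbd : ∀ (t : ℝ) (x : EuclideanSpace ℝ (Fin 3)), ‖v t x‖ ≤ 2)
    (_hI : ∃ I : ℝ≥0∞, I ≠ ⊤ ∧ ∀ r : ℝ, 0 < r → ∀ z : ℝ × EuclideanSpace ℝ (Fin 3),
      cknAEss r z v ≤ I ∧ cknC r z v ≤ I ∧ cknE r z (fun s y => fderiv ℝ (v s) y) ≤ I)
    (hL3 : ∃ (τ : ℕ → ℝ) (M : ℝ≥0∞), M < ⊤ ∧ Tendsto τ atTop atBot ∧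
      ∀ k, eLpNorm (v (τ k)) 3 volume ≤ M) :
    v 0 0 = 0 :=
  eq_zero_of_L3_slices_atBot hv hdiv hmild ⟨2, hbd⟩ hL3 0 0

end Summit.NavierStokesRegularity.NavierStokesRegularity.Theorems.TypeIliouvilleNoTypeII.TypeIIZoom

end
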